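import Summits.QuantumFields.BalabanUV.Beta.BorderedHessianSymmetry
import Summits.QuantumFields.BalabanUV.Beta.BorderedHessianKernelAction
import Literature.MathematicalPhysics.QuantumFieldTheory.Balaban1983to89.Beta.BalabanStepJets

/-!
# `BalabanUV.Beta.GAN24.TaylorLamLegEL` — binder row G-an2-4 / (CONV-C), S-slot road «S3-Taylor», SHAPE rows Λt∕Λ∕Λ0 (holder of ROW-Λt:
# b2b-balaban-gan24-formalise-leaf-10, gen 11; FINDING CLAIMS l.4674): THE MULTIPLIER-RESPONSE LEG THROUGH THE EULER–LAGRANGE IDENTITY —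
# `lamCoeffOf (KInv N) N μ y κ′ u = −(d*d ℋ^{(μ)})(κ′, u − N•y) = −(𝒬ᵀ wΦ^{(μ)})(κ′, u − N•y) − (d δ d wM^{(μ)})(κ′, u − N•y)`

NOT IN PRINT; OUR PROOF ATTEMPT (unit b2b-balaban-gan24-formalise-leaf-10, gen 11; drafted in records as `LamCoeffEL`, FILED as `GAN24/TaylorLamLegEL` on the row owner's
«GO» — gan24-p1-g4 RULINGS-7, CLAIMS l.4732, which ADOPTS the Euler–Lagrange route for the Λ rows and locates «(N1-gauge)»).  HONEST FRAMING (cell contract, verbatim):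
«discharging `BetaPertH` makes Bałaban's UV stability UNCONDITIONAL — a real constructive-QFT result; it is NOT the continuum limit and NOT the
Clay problem.»  HONEST DEPENDENCY (verbatim): «continuum YM on T⁴ ⇐ BetaPertH ∧ nine spine estimates (0/9 proved); BetaPertH ⇐ (D1) ∧ (D4) ∧
CAP+tail; G-an2-4 gates asym, D1 and NE2/3/4.»  [folklore] finite-stencil algebra over an2's DEFINITIONS (`BalabanStepJets.lamCoeffOf`∕`elCol`∕`box1`,
`OneStepResolventKernel.KInv`, `KernelSpecInstance.wH`∕`wΦ`∕`wM`∕`wH_EL`, `ResolventComposition.GamΦ_eq_neg_wH`, an2's `d*d` matrix lemmas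
`BorderedHessian.curvAdj_curv_eq_window_sum`∕`curvAdj_curv_delta1_symm`) BY NAME; generic dimension, generic blocking `N`; 0 cite, 0 `def … : Prop`,
no estimate; NOTHING of (hS, hSall) ∕ «E3Shape» is discharged.  NOT summit progress.

WHY (the power count of CLAIMS l.4674): the Lagrange rows' table `lagrInc = SLam N′ (lamCoeffOf (KInv N′) N′) (avgLift M ∘ hessFF Lc)` carries the
multiplier-response leg `lamCoeffOf (KInv N′) N′`; its ABSOLUTE bound (leaf L1 `TaylorLamLeg.abs_lamCoeffOf_KInv_le_unit`, unit `N^{−(d+2)}` of (N1))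
leaves the top Λ increment at `N^{d−1}·Lc^{−(d+3)}` instead of O(1).  The identity below rewrites the leg EXACTLY as minus `d*d` of the translated
minimiser column, hence — by an2's Euler–Lagrange identity `wH_EL` — as the K-slot multiplier leg `wΦ` read through `𝒬ᵀ` (`contourSumAdj N`:
`N` incidences per fine bond, so `N·|wΦ|`) plus the gauge-multiplier term `d δ d wM`; the first has the size the rows need, the second is
the located residual (a level-uniform unit for `wM` is not in the tree).

WHAT IS PROVED: `bondDelta_eq_delta1`; `box1_subset_cube2`; **`opEL_eq_sum_elCol`** `(d*d W)_{κ′}(x) = Σ_{v ∈ box1} Σ_l elCol κ′ x l (x+v) · W l (x+v)`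
(the `d*d` matrix written through an2's `elCol` at the OUTPUT bond; window `cube 2` cut to `box1` by `elCol_eq_zero_of_not_mem_box1`);
**`lamCoeffOf_KInv_eq_neg_opEL`** `lamCoeffOf (KInv N) N μ y κ′ u = −curvAdj (curv (fun α z ↦ wH α μ z)) κ′ (u − N•y)`;
**`lamCoeffOf_KInv_eq_EL`** `= −(contourSumAdj N (fun κ y′ ↦ wΦ κ μ y′) κ′ (u − N•y) + dz (codiff₁ (dz (wM μ))) κ′ (u − N•y))`.
-/

noncomputable section

open Finset
open scoped BigOperators
open Literature.MathematicalPhysics.QuantumFieldTheory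
open Literature.MathematicalPhysics.QuantumFieldTheory.Balaban1983to89
open Literature.MathematicalPhysics.QuantumFieldTheory.Balaban1983to89.Beta
open AffineAveraging (Site Form0 Form1 Form2 unitVec unitVec_apply dz curv curvAdj codiff₁)
open AffineReproduction (contourSumAdj)
open KKTFluctuationKernel (delta1 delta1_apply)
open OneStepResolventKernel (Fib KInv KInv_inr_inl_coarse)
open KernelSpecInstance (wH wΦ wM wH_EL)
open BalabanStepJets (bondDelta elCol box1 mem_box1 lamCoeffOf elCol_translate elCol_eq_zero_of_not_mem_box1)
open Summit.QuantumFields.BalabanUV.Beta.AxialDressingRooted (cube mem_cube)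
open Summit.QuantumFields.BalabanUV.Beta.BorderedHessian (curvAdj_curv_eq_window_sum curvAdj_curv_delta1_symm)

namespace Summit.QuantumFields.BalabanUV.Beta.GAN24.TaylorLamLegEL

variable {d : ℕ}

/-- [folklore] an2's two bond indicator one-forms coincide. -/
theorem bondDelta_eq_delta1 (κ' : Fin (d + 1)) (u : Site (d + 1)) : bondDelta κ' u = delta1 κ' u := rfl

/-- [folklore] The unit box sits inside the radius-2 window. -/
theorem box1_subset_cube2 : box1 (d + 1) ⊆ cube (d + 1) 2 := by
  intro v hv
  rw [mem_box1] at hv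
  rw [mem_cube]
  intro i
  rcases hv i with h | h | h <;> simp [h]

/-- [folklore] **THE `d*d` MATRIX THROUGH `elCol` AT THE OUTPUT BOND**: `(d*d W)_{κ′}(x) = Σ_{v ∈ box1} Σ_l elCol κ′ x l (x + v) · W l (x + v)` for every 1-form `W`. -/
theorem opEL_eq_sum_elCol (W : Form1 (d + 1) ℝ) (κ' : Fin (d + 1)) (x : Site (d + 1)) :
    curvAdj (curv W) κ' x = ∑ v ∈ box1 (d + 1), ∑ l : Fin (d + 1), elCol κ' x l (x + v) * W l (x + v) := by
  rw [curvAdj_curv_eq_window_sum]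
  have h1 : ∀ (v : Site (d + 1)) (l : Fin (d + 1)), curvAdj (curv (delta1 l (x + v))) κ' x = elCol κ' x l (x + v) := by
    intro v l
    rw [curvAdj_curv_delta1_symm]
    rfl
  simp_rw [h1]
  symm
  refine Finset.sum_subset box1_subset_cube2 fun v _ hv => ?_
  refine Finset.sum_eq_zero fun l _ => ?_
  rw [elCol_eq_zero_of_not_mem_box1 hv, zero_mul]

variable {N : ℕ} [NeZero N]

/-- [folklore] **THE MULTIPLIER-RESPONSE LEG IS MINUS `d*d` OF THE TRANSLATED MINIMISER COLUMN**:
`lamCoeffOf (KInv N) N μ y κ′ u = −(curvAdj (curv (fun α z ↦ wH α μ z))) κ′ (u − N•y)`. -/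
theorem lamCoeffOf_KInv_eq_neg_opEL (μ : Fin (d + 1)) (y : Site (d + 1)) (κ' : Fin (d + 1)) (u : Site (d + 1)) :
    lamCoeffOf (KInv (N := N) (d := d)) N μ y κ' u = -curvAdj (curv (fun α z => wH (N := N) α μ z)) κ' (u - (N : ℤ) • y) := by
  unfold lamCoeffOf
  rw [opEL_eq_sum_elCol, ← Finset.sum_neg_distrib]
  refine Finset.sum_congr rfl fun v _ => ?_
  rw [← Finset.sum_neg_distrib]
  refine Finset.sum_congr rfl fun α _ => ?_
  rw [KInv_inr_inl_coarse, ResolventComposition.GamΦ_eq_neg_wH]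
  have ht : elCol κ' (u - (N : ℤ) • y) α (u - (N : ℤ) • y + v) = elCol κ' u α (u + v) := by
    have h := elCol_translate κ' u (-((N : ℤ) • y)) α (u + v)
    rw [show u + -((N : ℤ) • y) = u - (N : ℤ) • y by abel, show u + v + -((N : ℤ) • y) = u - (N : ℤ) • y + v by abel] at h
    exact h
  rw [ht, show u + v - (N : ℤ) • y = u - (N : ℤ) • y + v by abel]
  ring

/-- [folklore] **THE MULTIPLIER-RESPONSE LEG THROUGH THE EULER–LAGRANGE IDENTITY** (`KernelSpecInstance.wH_EL`): the K-slot multiplier leg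
`wΦ` read through `𝒬ᵀ` plus the gauge-multiplier term. -/
theorem lamCoeffOf_KInv_eq_EL (μ : Fin (d + 1)) (y : Site (d + 1)) (κ' : Fin (d + 1)) (u : Site (d + 1)) :
    lamCoeffOf (KInv (N := N) (d := d)) N μ y κ' u =
      -(contourSumAdj N (fun κ y' => wΦ (N := N) κ μ y') κ' (u - (N : ℤ) • y)
        + dz (codiff₁ (dz (wM (N := N) μ))) κ' (u - (N : ℤ) • y)) := by
  rw [lamCoeffOf_KInv_eq_neg_opEL, wH_EL]

omit [NeZero N] in
/-- [folklore] **THE `𝒬ᵀ` MULTIPLICITY BOUND**: `|contourSumAdj N φ κ x| ≤ N · B` when `|φ| ≤ B` — `N` incidences per fine bond. -/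
theorem abs_contourSumAdj_le (φ : Form1 (d + 1) ℝ) {B : ℝ} (hφ : ∀ κ y, |φ κ y| ≤ B) (κ : Fin (d + 1)) (x : Site (d + 1)) :
    |contourSumAdj N φ κ x| ≤ N * B := by
  unfold AffineReproduction.contourSumAdj
  refine (Finset.abs_sum_le_sum_abs _ _).trans ?_
  calc ∑ s ∈ Finset.range N, |φ κ (fun i => (x - (s : ℤ) • unitVec κ) i / (N : ℤ))| ≤ ∑ _s ∈ Finset.range N, B :=
        Finset.sum_le_sum fun s _ => hφ κ _
    _ = N * B := by simp

end Summit.QuantumFields.BalabanUV.Beta.GAN24.TaylorLamLegEL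

end
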